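import Literature.Analysis.OperatorTheory.KnabeGapAmplification
import Literature.MathematicalPhysics.QuantumLattice.WilsonBlockHeatBath
import Literature.MathematicalPhysics.QuantumLattice.WilsonBlockHeatBathMarkov2
import Literature.MathematicalPhysics.QuantumLattice.WilsonBlockHeatBathMarkov3
import Literature.MathematicalPhysics.QuantumLattice.WilsonBlockHeatBathL2
import Literature.MathematicalPhysics.QuantumLattice.TorusWilsonGibbs
import Literature.MathematicalPhysics.QuantumFieldTheory.YangMillsOS
import Literature.MathematicalPhysics.QuantumFieldTheory.LatticeGaugeProofs
import Mathlib.MeasureTheory.Function.ConditionalExpectation.CondexpL2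
import Mathlib.MeasureTheory.Function.ConditionalExpectation.Real
import Mathlib.Analysis.InnerProductSpace.Positive

/-!
# Crux `LatticeGapInUVUnits`, line `knabe-block-sampler`: stub S3 `stub_samplerTranscription`

Support file for item stmt-QuantumFields-9366 (route `LangevinControlUV` of `YangMills`), registered stub
`stub_samplerTranscription` = `GapOfSquare → SamplerTranscription`: the overlapping block heat-bath sampler of the torus
Wilson theory IS a Knabe system on `L²(μ)^𝒢` — `Q_z = 1 − E[·|extSigma z]` are orthogonal projections preserving
gauge-invariant functions, commute at index distance `≥ 3` (Markov property of the plaquette interaction, tree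
`TorusWilsonGibbs`), the local Poincaré inequality gives `γ A_P ≤ A_P²`, Knabe (`KnabeWith 2 t c`) gives
`c(γ − t n₀) H ≤ H²`, `ker H` = constants, and the hypothesis `GapOfSquare` turns this into the global Poincaré
inequality. No definitions are introduced (vocabulary: `WilsonBlockHeatBath.lean`, `KnabeGapAmplification.lean`).

Structure: `samplerTranscription_abstract` is the Hilbert-space skeleton (Knabe's device `KnabeWith 2 t c` run for
`Q_z = (1 − E_z) P_V`, `P_V` the projection onto the closure of the invariant submodule; `GapOfSquare` converts
`g H ≤ H²` into the gap); `stub_samplerTranscription` instantiates it on `L²(wilsonMeasure ρ β)` with the block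
heat-bath projections of `Literature/MathematicalPhysics/QuantumLattice/WilsonBlockHeatBathL2.lean` (tower property,
far-block commutation = Markov property), `…Markov3.lean` (gauge covariance: `E_z` preserves the gauge-invariant
bounded classes), `…Markov2.lean` (`⋂_z 𝓕_{B_zᶜ}` trivial: `ker H` = constants), and unwinds `L²` norms into the
integrals of `LocalPoincare` / `GlobalPoincare`.
-/

open scoped BigOperators InnerProductSpace
open MeasureTheory Filter Topology
open Literature.MathematicalPhysics.QuantumFieldTheory Literature.MathematicalPhysics.QuantumLattice
open Literature.MathematicalPhysics.QuantumLattice.WilsonBlockHeatBath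
open Literature.Analysis.OperatorTheory.KnabeDevice

noncomputable section

namespace Summit.QuantumFields.YangMills.Theorems.LatticeGapInUVUnits.KnabeBlockSampler

variable {E : Type} [NormedAddCommGroup E] [InnerProductSpace ℝ E] [CompleteSpace E]

/-- A self-adjoint operator leaving a closed subspace invariant commutes with the orthogonal projection onto
it. [folklore] -/
theorem samplerTranscription_starProjection_commute (K : Submodule ℝ E) [K.HasOrthogonalProjection]
    {T : E →L[ℝ] E} (hT : IsSelfAdjoint T) (hK : ∀ v ∈ K, T v ∈ K) :
    K.starProjection * T = T * K.starProjection := by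
  ext f
  simp only [mul_apply_eq_comp]
  have h1 : T f = T (K.starProjection f) + T (f - K.starProjection f) := by
    rw [← map_add, add_sub_cancel]
  have h2 : T (f - K.starProjection f) ∈ Kᗮ := by
    intro v hv
    rw [← ContinuousLinearMap.adjoint_inner_left, hT.adjoint_eq]
    exact K.sub_starProjection_mem_orthogonal f _ (hK v hv)
  rw [h1, map_add, (K.starProjection_apply_eq_zero_iff).2 h2, add_zero,
    Submodule.starProjection_eq_self_iff.2 (hK _ (K.starProjection_apply_mem f))]

/-- For a self-adjoint idempotent `Q`, `⟪Q f, f⟫ = ‖Q f‖²`. [folklore] -/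
theorem samplerTranscription_inner_proj {Q : E →L[ℝ] E} (hsa : IsSelfAdjoint Q) (hid : Q * Q = Q)
    (f : E) : ⟪Q f, f⟫_ℝ = ‖Q f‖ ^ 2 := by
  conv_lhs => rw [← hid, mul_apply_eq_comp, ← ContinuousLinearMap.adjoint_inner_right,
    hsa.adjoint_eq]
  exact real_inner_self_eq_norm_sq _

/-- If `X` commutes with a self-adjoint idempotent `P` then `⟪X (P f), f⟫ = ⟪X (P f), P f⟫`. [folklore] -/
theorem samplerTranscription_inner_commute {X P : E →L[ℝ] E} (hP : IsSelfAdjoint P) (hPid : P * P = P)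
    (hXP : P * X = X * P) (f : E) : ⟪X (P f), f⟫_ℝ = ⟪X (P f), P f⟫_ℝ := by
  have : X (P f) = P (X (P f)) := by
    rw [← mul_apply_eq_comp P X, hXP, mul_apply_eq_comp, ← mul_apply_eq_comp P P, hPid]
  conv_lhs => rw [this, ← ContinuousLinearMap.adjoint_inner_right, hP.adjoint_eq]

/-- **Abstract form of the transcription** (Knabe's device run on an invariant subspace). Let `E_z`
(`z ∈ (ℤ/M)⁴`) be self-adjoint idempotents of a real Hilbert space commuting whenever the indices differ cyclically
by more than `2` in some axis, `S` a submodule with `E_z S ⊆ S̄`, `E_P(x)` self-adjoint operators with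
`E_z E_P(x) = E_P(x)` for `z` in the `n`-patch of `x`, such that the local inequality
`γ ‖f − E_P(x) f‖² ≤ ∑_{z ∈ patch(x)} ‖f − E_z f‖²` holds on `S`, and suppose every common fixed vector of the `E_z`
is a multiple of `u`. If `KnabeWith 2 t c` (`c > 0`, `1 ≤ n`, `4(n+2) ≤ M`, `t n < γ`) and the abstract spectral fact
"`0 ≤ H`, `g H ≤ H²`, `g > 0` ⇒ `g ‖x‖² ≤ ⟪Hx, x⟫` on `(ker H)ᗮ`" hold, then
`c (γ − t n) ‖f‖² ≤ ∑_z ‖f − E_z f‖²` for every `f ∈ S` orthogonal to `u`: Knabe is applied to the commuting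
self-adjoint idempotents `Q_z = (1 − E_z) P`, `P` the projection onto `S̄` (which commutes with the `E_z`), whose
patch operators satisfy `γ A ≤ A²` by the local inequality and Cauchy–Schwarz. [folklore] -/
theorem samplerTranscription_abstract
    (hGap : ∀ (E : Type) [NormedAddCommGroup E] [InnerProductSpace ℝ E] [CompleteSpace E]
      (H : E →L[ℝ] E) (g : ℝ), 0 ≤ H → 0 < g → g • H ≤ H * H →
        ∀ x : E, (∀ y : E, H y = 0 → ⟪x, y⟫_ℝ = 0) → g * ‖x‖ ^ 2 ≤ ⟪H x, x⟫_ℝ)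
    {t : ℕ → ℝ} {c : ℝ} (hK : KnabeWith 2 t c) (hc : 0 < c) {M n : ℕ} (hn : 1 ≤ n)
    (hM : 4 * (n + 2) ≤ M) {γ : ℝ} (hγ : 0 < γ) (htγ : t n < γ) (S : Submodule ℝ E)
    (Epr : (Fin 4 → Fin M) → E →L[ℝ] E) (hsa : ∀ z, IsSelfAdjoint (Epr z))
    (hid : ∀ z, Epr z * Epr z = Epr z) (hES : ∀ z, ∀ f ∈ S, Epr z f ∈ S.topologicalClosure)
    (hcomm : ∀ z w, (∃ k, 2 < cdist (z k) (w k)) → Epr z * Epr w = Epr w * Epr z)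
    (EP : (Fin 4 → Fin M) → E →L[ℝ] E) (hPsa : ∀ x, IsSelfAdjoint (EP x))
    (hnest : ∀ x z, (∀ k, cdist (z k) (x k) < n) → Epr z * EP x = EP x)
    (hloc : ∀ x, ∀ f ∈ S, γ * ‖f - EP x f‖ ^ 2 ≤
      ∑ z, if (∀ k, cdist (z k) (x k) < n) then ‖f - Epr z f‖ ^ 2 else 0)
    (u : E) (hker : ∀ f, (∀ z, Epr z f = f) → ∃ a : ℝ, f = a • u) :
    ∀ f ∈ S, ⟪f, u⟫_ℝ = 0 → c * (γ - t n) * ‖f‖ ^ 2 ≤ ∑ z, ‖f - Epr z f‖ ^ 2 := by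
  -- the closed invariant subspace and its projection
  set V : Submodule ℝ E := S.topologicalClosure with hV
  haveI : CompleteSpace V := S.isClosed_topologicalClosure.completeSpace_coe
  set P : E →L[ℝ] E := V.starProjection with hP
  have hPsa' : IsSelfAdjoint P := isSelfAdjoint_starProjection V
  have hPid : P * P = P := V.isIdempotentElem_starProjection.eq
  have hPV : ∀ v ∈ V, P v = v := fun v hv => Submodule.starProjection_eq_self_iff.2 hv
  -- `Epr z` leaves `V` invariant, hence commutes with `P`
  have hEV : ∀ z, ∀ v ∈ V, Epr z v ∈ V := by
    intro z v hv
    have : S.topologicalClosure ≤ V.comap (Epr z : E →ₗ[ℝ] E) := by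
      refine S.topologicalClosure_minimal (fun f hf => ?_) ?_
      · exact hES z f hf
      · exact S.isClosed_topologicalClosure.preimage (Epr z).continuous
    exact this hv
  have hPE : ∀ z, P * Epr z = Epr z * P := fun z =>
    samplerTranscription_starProjection_commute V (hsa z) (hEV z)
  -- the heat-bath projections `Q z = (1 - Epr z) P`
  set Q1 : (Fin 4 → Fin M) → E →L[ℝ] E := fun z => 1 - Epr z with hQ1
  have hQ1sa : ∀ z, IsSelfAdjoint (Q1 z) := fun z => (IsSelfAdjoint.one _).sub (hsa z)
  have hQ1id : ∀ z, Q1 z * Q1 z = Q1 z := fun z => by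
    simp only [hQ1, mul_sub, sub_mul, one_mul, mul_one, hid]; abel
  have hPQ1 : ∀ z, P * Q1 z = Q1 z * P := fun z => by
    simp only [hQ1, mul_sub, sub_mul, one_mul, mul_one, hPE]
  have hQ1n : ∀ z f, ⟪Q1 z f, f⟫_ℝ = ‖f - Epr z f‖ ^ 2 := fun z f => by
    rw [samplerTranscription_inner_proj (hQ1sa z) (hQ1id z)]
    simp [hQ1]
  set Q : (Fin 4 → Fin M) → E →L[ℝ] E := fun z => Q1 z * P with hQ
  have hQQ : ∀ z w, Q z * Q w = Q1 z * Q1 w * P := fun z w =>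
    calc Q1 z * P * (Q1 w * P) = Q1 z * (P * Q1 w) * P := by simp only [mul_assoc]
      _ = Q1 z * (Q1 w * P) * P := by rw [hPQ1]
      _ = Q1 z * Q1 w * P := by simp only [mul_assoc, hPid]
  have hQsa : ∀ z, IsSelfAdjoint (Q z) := fun z =>
    (IsSelfAdjoint.commute_iff (hQ1sa z) hPsa').1 (hPQ1 z).symm
  have hQid : ∀ z, Q z * Q z = Q z := fun z => by rw [hQQ, hQ1id]
  have hQcomm : ∀ z w, (∃ k, 2 < cdist (z k) (w k)) → Q z * Q w = Q w * Q z := by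
    intro z w hzw
    have h1 : Q1 z * Q1 w = Q1 w * Q1 z := by
      simp only [hQ1, mul_sub, sub_mul, one_mul, mul_one, hcomm z w hzw]; abel
    rw [hQQ, hQQ, h1]
  -- patch operators: `patchOp Q n x = A x * P` with `A x = ∑_{patch} Q1`
  set A : (Fin 4 → Fin M) → E →L[ℝ] E := fun x =>
    ∑ y : Fin 4 → Fin M, if (∀ k, cdist (y k) (x k) < n) then Q1 y else 0 with hA
  have hpatch : ∀ x, patchOp Q n x = A x * P := fun x => by
    simp only [patchOp, hA, Finset.sum_mul]
    refine Finset.sum_congr rfl fun y _ => ?_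
    split_ifs <;> simp [hQ]
  have hAsa : ∀ x, IsSelfAdjoint (A x) := fun x =>
    isSelfAdjoint_sum _ fun y _ => by
      split_ifs
      · exact hQ1sa y
      · exact IsSelfAdjoint.zero _
  have hPA : ∀ x, P * A x = A x * P := fun x => by
    simp only [hA, Finset.mul_sum, Finset.sum_mul]
    refine Finset.sum_congr rfl fun y _ => ?_
    split_ifs
    · exact hPQ1 y
    · simp
  have hAinner : ∀ x f, ⟪A x f, f⟫_ℝ =
      ∑ z, if (∀ k, cdist (z k) (x k) < n) then ‖f - Epr z f‖ ^ 2 else 0 := fun x f => by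
    simp only [hA, FunLike.coe_sum, Finset.sum_apply, sum_inner]
    refine Finset.sum_congr rfl fun y _ => ?_
    split_ifs
    · exact hQ1n y f
    · simp
  -- `A x = A x * (1 - EP x) = (1 - EP x) * A x`
  have hAQ : ∀ x, A x * (1 - EP x) = A x := fun x => by
    simp only [hA, Finset.sum_mul]
    refine Finset.sum_congr rfl fun y _ => ?_
    split_ifs with hy
    · simp only [hQ1, mul_sub, sub_mul, one_mul, mul_one, hnest x y hy]; abel
    · simp
  have hQA : ∀ x, (1 - EP x) * A x = A x := fun x => by
    simp only [hA, Finset.mul_sum]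
    refine Finset.sum_congr rfl fun y _ => ?_
    split_ifs with hy
    · have h' : EP x * Epr y = EP x := by
        have := congrArg star (hnest x y hy)
        rwa [star_mul, (hsa y).star_eq, (hPsa x).star_eq] at this
      simp only [hQ1, mul_sub, sub_mul, one_mul, mul_one, h']; abel
    · simp
  -- (★) on `V`: `γ ‖(1 - EP x) g‖² ≤ ⟪A x g, g⟫`
  have hstar : ∀ x, ∀ g ∈ V, γ * ‖g - EP x g‖ ^ 2 ≤ ⟪A x g, g⟫_ℝ := by
    intro x g hg
    have hcl : IsClosed {g : E | γ * ‖g - EP x g‖ ^ 2 ≤ ⟪A x g, g⟫_ℝ} :=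
      isClosed_le (by fun_prop) (Continuous.inner (A x).continuous continuous_id)
    have hsub : (S : Set E) ⊆ {g : E | γ * ‖g - EP x g‖ ^ 2 ≤ ⟪A x g, g⟫_ℝ} := fun f hf => by
      simp only [Set.mem_setOf_eq, hAinner]; exact hloc x f hf
    have : (V : Set E) ⊆ {g : E | γ * ‖g - EP x g‖ ^ 2 ≤ ⟪A x g, g⟫_ℝ} := by
      rw [hV, Submodule.topologicalClosure_coe]; exact hcl.closure_subset_iff.2 hsub
    exact this hg
  -- (★★) on `V`: `γ ⟪A g, g⟫ ≤ ‖A g‖²`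
  have hstar2 : ∀ x, ∀ g ∈ V, γ * ⟪A x g, g⟫_ℝ ≤ ‖A x g‖ ^ 2 := by
    intro x g hg
    set G : E := g - EP x g with hG
    have hG' : G = (1 - EP x) g := by simp [hG]
    have hAG : A x g = A x G := by rw [hG', ← mul_apply_eq_comp, hAQ]
    have hin : ⟪A x g, g⟫_ℝ = ⟪A x G, G⟫_ℝ := by
      rw [hAG]
      conv_lhs => rw [← hQA x, mul_apply_eq_comp, ← ContinuousLinearMap.adjoint_inner_right,
        ((IsSelfAdjoint.one _).sub (hPsa x)).adjoint_eq]
      rw [hG']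
    have h1 : γ * ‖G‖ ^ 2 ≤ ⟪A x G, G⟫_ℝ := by rw [← hin]; exact hstar x g hg
    have hCS : ⟪A x G, G⟫_ℝ ≤ ‖A x G‖ * ‖G‖ := real_inner_le_norm _ _
    rw [hin, hAG]
    by_cases hG0 : ‖G‖ = 0
    · have : G = 0 := norm_eq_zero.1 hG0
      simp [this]
    · have hGpos : 0 < ‖G‖ := lt_of_le_of_ne (norm_nonneg _) (Ne.symm hG0)
      have h2 : γ * ‖G‖ ≤ ‖A x G‖ := by
        have : γ * ‖G‖ * ‖G‖ ≤ ‖A x G‖ * ‖G‖ := by nlinarith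
        exact le_of_mul_le_mul_right this hGpos
      nlinarith [norm_nonneg (A x G)]
  -- the Loewner patch inequality `γ • patchOp ≤ patchOp²`
  have hLoewner : ∀ x, γ • patchOp Q n x ≤ patchOp Q n x * patchOp Q n x := by
    intro x
    rw [hpatch, ContinuousLinearMap.le_def, ContinuousLinearMap.isPositive_iff']
    have hAPsa : IsSelfAdjoint (A x * P) := (IsSelfAdjoint.commute_iff (hAsa x) hPsa').1 (hPA x).symm
    refine ⟨(((hAPsa.commute_iff hAPsa).1 (Commute.refl _))).sub ((IsSelfAdjoint.all γ).smul hAPsa),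
      fun f => ?_⟩
    have hAPAP : A x * P * (A x * P) = A x * A x * P :=
      calc A x * P * (A x * P) = A x * (P * A x) * P := by simp only [mul_assoc]
        _ = A x * (A x * P) * P := by rw [hPA]
        _ = A x * A x * P := by simp only [mul_assoc, hPid]
    rw [hAPAP]
    simp only [sub_apply, smul_apply, mul_apply_eq_comp, inner_sub_left, real_inner_smul_left,
      sub_nonneg]
    have hPAA : P * (A x * A x) = A x * A x * P := by
      rw [← mul_assoc, hPA, mul_assoc, hPA, mul_assoc]
    have key : ∀ g, ⟪A x (A x g), g⟫_ℝ = ‖A x g‖ ^ 2 := fun g => by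
      rw [← ContinuousLinearMap.adjoint_inner_right, (hAsa x).adjoint_eq, real_inner_self_eq_norm_sq]
    rw [samplerTranscription_inner_commute hPsa' hPid (hPA x),
      ← mul_apply_eq_comp (A x) (A x), samplerTranscription_inner_commute hPsa' hPid hPAA,
      mul_apply_eq_comp, key]
    exact hstar2 x _ (V.starProjection_apply_mem f)
  -- Knabe
  have hKnabe := hK M E Q (fun z => ⟨hQsa z, hQid z⟩) hQcomm n γ hn hM hγ.le hLoewner
  -- the total operator
  set Htot : E →L[ℝ] E := ∑ z : Fin 4 → Fin M, Q1 z with hHtot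
  have htot : totalOp Q = Htot * P := by simp only [totalOp, hHtot, Finset.sum_mul, hQ]
  have hg : 0 < c * (γ - t n) := mul_pos hc (sub_pos.2 htγ)
  have hpos : 0 ≤ totalOp Q := by
    rw [ContinuousLinearMap.nonneg_iff_isPositive, totalOp]
    exact ContinuousLinearMap.isPositive_sum _ fun z _ =>
      (ContinuousLinearMap.IsIdempotentElem.isPositive_iff_isSelfAdjoint (hQid z)).2 (hQsa z)
  have hGap' := hGap E (totalOp Q) (c * (γ - t n)) hpos hg hKnabe
  -- conclusion
  intro f hf hfu
  have hfV : f ∈ V := S.le_topologicalClosure hf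
  have horth : ∀ y : E, totalOp Q y = 0 → ⟪f, y⟫_ℝ = 0 := by
    intro y hy
    rw [htot, mul_apply_eq_comp] at hy
    -- `P y` is fixed by every `Epr z`
    have hsum : ∑ z, ‖P y - Epr z (P y)‖ ^ 2 = 0 := by
      have : ⟪Htot (P y), P y⟫_ℝ = 0 := by rw [hy, inner_zero_left]
      rw [hHtot, FunLike.coe_sum, Finset.sum_apply, sum_inner] at this
      simpa only [hQ1n] using this
    have hfix : ∀ z, Epr z (P y) = P y := fun z => by
      have := (Finset.sum_eq_zero_iff_of_nonneg fun z _ => sq_nonneg _).1 hsum z (Finset.mem_univ _)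
      rw [sq_eq_zero_iff, norm_eq_zero, sub_eq_zero] at this
      exact this.symm
    obtain ⟨a, ha⟩ := hker (P y) hfix
    rw [← hPV f hfV, hP, Submodule.inner_starProjection_left_eq_right, ← hP, ha, real_inner_smul_right,
      hfu, mul_zero]
  have := hGap' f horth
  rw [htot, mul_apply_eq_comp, hPV f hfV, hHtot, FunLike.coe_sum, Finset.sum_apply, sum_inner] at this
  simpa only [hQ1n] using this

/-! ### The stub -/

/-- **Stub S3 of line `knabe-block-sampler`** (transcription of the block sampler into Knabe's algebra): given the
abstract spectral fact `GapOfSquare`, the local Poincaré inequality with `γ > t n₀` on a torus with `(4n₀+8)b ≤ N`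
gives the global one with constant `c (γ − t n₀)`, for every `(t, c)` with `KnabeWith 2 t c`, `c > 0`. -/
theorem stub_samplerTranscription : (∀ (E : Type) [NormedAddCommGroup E] [InnerProductSpace ℝ E] [CompleteSpace E] (H : E →L[ℝ] E) (g : ℝ), 0 ≤ H → 0 < g → g • H ≤ H * H → ∀ x : E, (∀ y : E, H y = 0 → ⟪x, y⟫_ℝ = 0) → g * ‖x‖ ^ 2 ≤ ⟪H x, x⟫_ℝ) → ∀ (t : ℕ → ℝ) (c : ℝ), KnabeWith 2 t c → 0 < c → ∀ (G : Type) [Group G] [TopologicalSpace G] [IsTopologicalGroup G] [CompactSpace G] [MeasurableSpace G] [BorelSpace G] (r : LatticeRep G) (β : ℝ) (N b n₀ : ℕ) [NeZero N] (γ : ℝ), 1 ≤ n₀ → 1 ≤ b → (4 * n₀ + 8) * b ≤ N → 0 < γ → t n₀ < γ → LocalPoincare r.ρ β N b n₀ γ → GlobalPoincare r.ρ β N b (c * (γ - t n₀)) := by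
  intro hGap t c hK hc G _ _ _ _ _ _ r β N b n₀ _ γ hn₀ hb hN hγ htγ hloc
  -- a faithful continuous finite-dimensional representation makes `G` metrisable
  haveI : T2Space G := (r.continuous.isClosedEmbedding r.injective).isEmbedding.t2Space
  haveI : SecondCountableTopology G :=
    (r.continuous.isClosedEmbedding r.injective).isEmbedding.secondCountableTopology
  -- the number of cells per axis
  set m : ℕ := N / b with hm
  have hm4 : 4 * (n₀ + 2) ≤ m := (Nat.le_div_iff_mul_le (by omega)).2 (by nlinarith)
  haveI : NeZero m := ⟨by omega⟩
  have hmN : m ≤ N := Nat.div_le_self N b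
  -- the Wilson state and its `L²`
  haveI := isProbabilityMeasure_wilsonMeasure (d := 4) (L := N) (G := G) r.ρ r.continuous β
  set μ := wilsonMeasure (d := 4) (L := N) r.ρ β with hμ
  set Epr : (Fin 4 → Fin m) → (Lp ℝ 2 μ →L[ℝ] Lp ℝ 2 μ) := fun z =>
    (lpMeas ℝ ℝ (extSigma G N m z) 2 μ).subtypeL ∘L condExpL2 ℝ ℝ (linkSigma_le _) with hEpr
  set EP : (Fin 4 → Fin m) → (Lp ℝ 2 μ →L[ℝ] Lp ℝ 2 μ) := fun x =>
    (lpMeas ℝ ℝ (patchExtSigma G N m n₀ x) 2 μ).subtypeL ∘L condExpL2 ℝ ℝ (linkSigma_le _) with hEP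
  have hprops := fun z => heatBathProj_props (μ := μ) (linkSigma_le (G := G) {e | ¬ InBlock N m z e.1})
  -- the constants
  have h1 : MemLp (fun _ : GaugeConfig 4 N G => (1 : ℝ)) 2 μ := memLp_const 1
  set u : Lp ℝ 2 μ := h1.toLp _ with hu
  have hu1 : (u : GaugeConfig 4 N G → ℝ) =ᵐ[μ] fun _ => 1 := h1.coeFn_toLp
  -- the gauge-invariant bounded classes
  set S : Submodule ℝ (Lp ℝ 2 μ) :=
    { carrier := {f | ∃ F : GaugeConfig 4 N G → ℝ, Measurable F ∧ (∃ B, ∀ U, |F U| ≤ B) ∧ IsGaugeInvariant F ∧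
        (f : GaugeConfig 4 N G → ℝ) =ᵐ[μ] F}
      add_mem' := by
        rintro f g ⟨F, hFm, ⟨B, hB⟩, hFi, hfF⟩ ⟨F', hFm', ⟨B', hB'⟩, hFi', hfF'⟩
        refine ⟨F + F', hFm.add hFm', ⟨B + B', fun U => (abs_add_le _ _).trans (add_le_add (hB U) (hB' U))⟩,
          fun g' U => by simp only [Pi.add_apply, hFi g' U, hFi' g' U], (Lp.coeFn_add f g).trans (hfF.add hfF')⟩
      zero_mem' := ⟨0, measurable_const, ⟨0, fun U => by simp⟩, fun _ _ => rfl, Lp.coeFn_zero ℝ 2 μ⟩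
      smul_mem' := by
        rintro a f ⟨F, hFm, ⟨B, hB⟩, hFi, hfF⟩
        refine ⟨a • F, hFm.const_smul a, ⟨|a| * B, fun U => ?_⟩, fun g' U => by
          simp only [Pi.smul_apply, hFi g' U], (Lp.coeFn_smul a f).trans (hfF.mono fun x hx => by
            simp only [Pi.smul_apply, hx])⟩
        rw [Pi.smul_apply, smul_eq_mul, abs_mul]
        exact mul_le_mul_of_nonneg_left (hB U) (abs_nonneg a) } with hS
  -- norms of `f - E f` as integrals
  have hnorm : ∀ (f : Lp ℝ 2 μ) (F : GaugeConfig 4 N G → ℝ), (f : GaugeConfig 4 N G → ℝ) =ᵐ[μ] F →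
      ∀ (S' : Set (Edge 4 N)),
      ‖f - ((lpMeas ℝ ℝ (linkSigma (G := G) S') 2 μ).subtypeL ∘L condExpL2 ℝ ℝ (linkSigma_le S')) f‖ ^ 2 =
        ∫ U, (F U - (μ[F | linkSigma S']) U) ^ 2 ∂μ := by
    intro f F hfF S'
    refine norm_sq_eq_integral_sq _ ((Lp.coeFn_sub _ _).trans (hfF.sub ?_))
    exact (heatBathProj_ae_eq_condExp _ f).trans (condExp_congr_ae hfF)
  -- the abstract transcription
  have key := samplerTranscription_abstract hGap hK hc hn₀ hm4 hγ htγ S Epr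
    (fun z => (hprops z).1) (fun z => (hprops z).2.1) ?hES ?hcomm EP
    (fun x => (heatBathProj_props (μ := μ) (linkSigma_le _)).1) ?hnest ?hloc u ?hker
  case hES =>
    rintro z f ⟨F, hFm, ⟨B, hB⟩, hFi, hfF⟩
    apply S.le_topologicalClosure
    obtain ⟨F₁, hF₁m, hF₁b, hF₁i, hF₁ae⟩ := exists_isGaugeInvariant_version_condExp_linkSigma (N := N) r.ρ
      r.continuous β {e | ¬ InBlock N m z e.1} hFm hB hFi
    exact ⟨F₁, hF₁m, ⟨B, hF₁b⟩, hF₁i,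
      (heatBathProj_ae_eq_condExp _ f).trans ((condExp_congr_ae hfF).trans hF₁ae.symm)⟩
  case hcomm =>
    intro z w hzw
    exact heatBathProj_commute_of_far r.ρ r.continuous β hmN hzw
  case hnest =>
    intro x z hxz
    exact (heatBathProj_comp (μ := μ) (linkSigma_le _) (linkSigma_le _)
      (patchExtSigma_le_extSigma (G := G) (N := N) (show InPatch n₀ x z from hxz))).1
  case hloc =>
    rintro x f ⟨F, hFm, hFb, hFi, hfF⟩
    have hL := (le_inv_mul_iff₀ hγ).1 (hloc x F hFm hFb hFi)
    rw [hnorm f F hfF]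
    refine hL.trans (le_of_eq (Finset.sum_congr rfl fun z _ => ?_))
    rw [hnorm f F hfF]
    exact if_congr Iff.rfl rfl rfl
  case hker =>
    intro f hf
    have hfz : ∀ z, AEStronglyMeasurable[extSigma G N m z] (f : GaugeConfig 4 N G → ℝ) μ := fun z =>
      mem_lpMeas_iff_aestronglyMeasurable.1 (by rw [← hf z]; exact (hprops z).2.2.1 f)
    obtain ⟨a, ha⟩ := ae_eq_const_of_forall_aestronglyMeasurable_extSigma (N := N) r.ρ r.continuous β
      (Lp.aestronglyMeasurable f) hfz
    refine ⟨a, Lp.ext (ha.trans ?_)⟩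
    exact ((Lp.coeFn_smul a u).trans (hu1.mono fun x hx => by simp [hx])).symm
  -- unwind for a bounded measurable gauge-invariant `F`
  intro F hFm hFb hFi
  obtain ⟨B, hB⟩ := hFb
  have hFint : Integrable F μ := Integrable.of_bound hFm.aestronglyMeasurable B
    (ae_of_all _ fun U => by rw [Real.norm_eq_abs]; exact hB U)
  have hFmem : MemLp F 2 μ := MemLp.of_bound hFm.aestronglyMeasurable B
    (ae_of_all _ fun U => by rw [Real.norm_eq_abs]; exact hB U)
  set a : ℝ := ∫ V, F V ∂μ with ha
  set f : Lp ℝ 2 μ := hFmem.toLp F - a • u with hf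
  have hfF : ((hFmem.toLp F : Lp ℝ 2 μ) : GaugeConfig 4 N G → ℝ) =ᵐ[μ] F := hFmem.coeFn_toLp
  have hf_coe : (f : GaugeConfig 4 N G → ℝ) =ᵐ[μ] fun U => F U - a :=
    (Lp.coeFn_sub _ _).trans (hfF.sub ((Lp.coeFn_smul a u).trans (hu1.mono fun x hx => by simp [hx])))
  have hfS : f ∈ S := S.sub_mem ⟨F, hFm, ⟨B, hB⟩, hFi, hfF⟩
    (S.smul_mem a ⟨fun _ => 1, measurable_const, ⟨1, fun U => by simp⟩, fun _ _ => rfl, hu1⟩)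
  have hfu : ⟪f, u⟫_ℝ = 0 := by
    rw [MeasureTheory.L2.inner_def]
    have : (fun U => ⟪(f : GaugeConfig 4 N G → ℝ) U, (u : GaugeConfig 4 N G → ℝ) U⟫_ℝ) =ᵐ[μ] fun U => F U - a := by
      filter_upwards [hf_coe, hu1] with U h1U h2U
      simp [h1U, h2U]
    rw [integral_congr_ae this, integral_sub hFint (integrable_const a), integral_const, probReal_univ, one_smul,
      sub_self]
  have hineq := key f hfS hfu
  -- translate norms into integrals
  have hn1 : ‖f‖ ^ 2 = ∫ U, (F U - a) ^ 2 ∂μ := norm_sq_eq_integral_sq f hf_coe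
  have hn2 : ∀ z, ‖f - Epr z f‖ ^ 2 = ∫ U, (F U - (μ[F | extSigma G N m z]) U) ^ 2 ∂μ := by
    intro z
    refine norm_sq_eq_integral_sq _ ((Lp.coeFn_sub _ _).trans ?_)
    have h2 : μ[(f : GaugeConfig 4 N G → ℝ) | extSigma G N m z] =ᵐ[μ] fun U => (μ[F | extSigma G N m z]) U - a := by
      refine (condExp_congr_ae hf_coe).trans ?_
      have : (fun U => F U - a) = F - fun _ => a := rfl
      rw [this]
      refine (condExp_sub hFint (integrable_const a) _).trans ?_
      rw [condExp_const (linkSigma_le _)]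
      exact ae_of_all _ fun U => rfl
    filter_upwards [hf_coe, (heatBathProj_ae_eq_condExp _ f).trans h2] with U h1U h2U
    rw [Pi.sub_apply, h1U, h2U]; ring
  rw [hn1] at hineq
  simp only [hn2] at hineq
  exact (le_inv_mul_iff₀ (mul_pos hc (sub_pos.2 htγ))).2 hineq

end Summit.QuantumFields.YangMills.Theorems.LatticeGapInUVUnits.KnabeBlockSampler

end
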